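import Literature.Analysis.SpecialFunctions.RiemannThetaGradient
import Literature.NumberTheory.ModularForms.BinaryThetaWeighted
import Mathlib.Analysis.Complex.UpperHalfPlane.Manifold
import Mathlib.Analysis.Complex.UpperHalfPlane.FunctionsBoundedAtInfty
import Mathlib.Analysis.Complex.LocallyUniformLimit
import Mathlib.Logic.Equiv.Fin.Basic
import HarnessLib

/-!
# Gradient theta nulls on lines `τ ↦ τ·P`: integral shifts, level raising, decay, holomorphy
# (toward K0⁺, stmt-20690)

Route `ResidualThetaTransportAtTwo`, crux K0⁺ `HeckeThetaPartnerAdicAtTwo` (stmt-BirchSwinnertonDyer-20690),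
line "Hecke theta series from the genus-two Riemann theta function".  THEOREMS ONLY.

Analytic tools for the cusp conditions of the Hecke theta series.  The class of functions
`τ ↦ ∇_u ϑ[a; b](0, τ·P)` (`a, b ∈ ℚ²`, `P ∈ Sym₂(ℚ)` positive definite, `u ∈ ℂ²`):

* `riemannThetaChar_add_intSymm` — `ϑ[a;b](z, Ω + S) = e(-πi ᵗaSa) ϑ[a; b + Sa](z, Ω)` for an
  integral symmetric `S` with even diagonal (the action of `(1 S; 0 1)`);
* `riemannThetaChar_eq_sum_level` — `ϑ[a;b](z, Ω) = Σ_{m₀ ∈ (ℤ/n)²} ϑ[(m₀+a)/n; nb](nz, n²Ω)`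
  (splitting `m = nm' + m₀`);
* `norm_riemannThetaCharTerm_line` — `|general term| = e^{-π Im τ · Q(m+a)}`, `Q(x) = ᵗxPx`;
* `isZeroAtImInfty_fderiv_line` — `τ ↦ ∇_u ϑ[a;b](0, τ·P)` tends to `0` at `i∞`;
* `mdifferentiable_fderiv_line` — and is holomorphic on `ℍ`.

BSD is not proved by this file.
-/

set_option autoImplicit false
set_option linter.dupNamespace false

noncomputable section

open scoped Real MatrixGroups UpperHalfPlane Topology Manifold
open Matrix Complex Filter

namespace Summit.BirchSwinnertonDyer.BirchSwinnertonDyer.Theorems.HeckeTheta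

open Literature.Analysis.SpecialFunctions
open Literature.NumberTheory.ModularForms.BinaryTheta
open Literature.NumberTheory.Automorphic (siegelUpperHalfSpace mem_siegelUpperHalfSpace_iff)

/-! ### Integral symmetric shifts of the period matrix -/

/-- Termwise version of `riemannThetaChar_add_intSymm`. -/
theorem riemannThetaCharTerm_add_intSymm {S : Matrix (Fin 2) (Fin 2) ℤ} (hS : S.IsSymm)
    (h00 : Even (S 0 0)) (h11 : Even (S 1 1)) (a b : Fin 2 → ℂ) (Ω : Matrix (Fin 2) (Fin 2) ℂ)
    (z : Fin 2 → ℂ) (m : Fin 2 → ℤ) :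
    riemannThetaCharTerm a b (Ω + S.map ((↑) : ℤ → ℂ)) z m =
      cexp (-(π * I * (a ⬝ᵥ (S.map ((↑) : ℤ → ℂ) *ᵥ a)))) *
        riemannThetaCharTerm a (b + S.map ((↑) : ℤ → ℂ) *ᵥ a) Ω z m := by
  obtain ⟨e0, he0⟩ := h00
  obtain ⟨e1, he1⟩ := h11
  have h10 : S 1 0 = S 0 1 := hS.apply 0 1
  rw [riemannThetaCharTerm, riemannThetaCharTerm, ← Complex.exp_add]
  -- the exponents differ by `2πi k`, `k = ½ ᵗmSm ∈ ℤ`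
  set k : ℤ := e0 * m 0 ^ 2 + S 0 1 * m 0 * m 1 + e1 * m 1 ^ 2 with hk
  rw [show π * I * (((fun i => (m i : ℂ)) + a) ⬝ᵥ ((Ω + S.map ((↑) : ℤ → ℂ)) *ᵥ ((fun i => (m i : ℂ)) + a))) +
      2 * π * I * (((fun i => (m i : ℂ)) + a) ⬝ᵥ (z + b)) =
      -(π * I * (a ⬝ᵥ (S.map ((↑) : ℤ → ℂ) *ᵥ a))) +
        (π * I * (((fun i => (m i : ℂ)) + a) ⬝ᵥ (Ω *ᵥ ((fun i => (m i : ℂ)) + a))) +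
          2 * π * I * (((fun i => (m i : ℂ)) + a) ⬝ᵥ (z + (b + S.map ((↑) : ℤ → ℂ) *ᵥ a)))) +
        (k : ℂ) * (2 * π * I) by
    simp only [dotProduct, Matrix.mulVec, Fin.sum_univ_two, Matrix.add_apply, Matrix.map_apply,
      Pi.add_apply, h10, hk]
    push_cast
    rw [he0, he1]
    push_cast
    ring, Complex.exp_add, Complex.exp_int_mul_two_pi_mul_I, mul_one]

/-- **`ϑ[a; b](z, Ω + S) = e(-πi ᵗaSa) · ϑ[a; b + Sa](z, Ω)`** for an integral symmetric `S` with
even diagonal (the theta transformation law for `(1 S; 0 1) ∈ Sp₄(ℤ)`, elementary: termwise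
`ᵗmSm ∈ 2ℤ`). -/
theorem riemannThetaChar_add_intSymm {S : Matrix (Fin 2) (Fin 2) ℤ} (hS : S.IsSymm)
    (h00 : Even (S 0 0)) (h11 : Even (S 1 1)) (a b : Fin 2 → ℂ) (Ω : Matrix (Fin 2) (Fin 2) ℂ)
    (z : Fin 2 → ℂ) :
    riemannThetaChar a b (Ω + S.map ((↑) : ℤ → ℂ)) z =
      cexp (-(π * I * (a ⬝ᵥ (S.map ((↑) : ℤ → ℂ) *ᵥ a)))) *
        riemannThetaChar a (b + S.map ((↑) : ℤ → ℂ) *ᵥ a) Ω z := by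
  unfold riemannThetaChar
  rw [← tsum_mul_left]
  exact tsum_congr fun m => riemannThetaCharTerm_add_intSymm hS h00 h11 a b Ω z m

/-! ### Level raising: splitting `m = n m' + m₀` -/

/-- Termwise: the term of `ϑ[a;b](z,Ω)` at `n m' + m₀` is the term of
`ϑ[(m₀+a)/n; nb](nz, n²Ω)` at `m'`. -/
theorem riemannThetaCharTerm_level (a b : Fin 2 → ℂ) (Ω : Matrix (Fin 2) (Fin 2) ℂ) (z : Fin 2 → ℂ)
    {n : ℕ} (hn : 0 < n) (m₀ : Fin 2 → Fin n) (m' : Fin 2 → ℤ) :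
    riemannThetaCharTerm a b Ω z (fun i => m' i * (n : ℤ) + ((m₀ i : ℕ) : ℤ)) =
      riemannThetaCharTerm (fun i => ((((m₀ i : ℕ) : ℂ)) + a i) / n) ((n : ℂ) • b)
        (((n : ℂ) ^ 2) • Ω) ((n : ℂ) • z) m' := by
  have hn' : (n : ℂ) ≠ 0 := by exact_mod_cast hn.ne'
  rw [riemannThetaCharTerm, riemannThetaCharTerm]
  congr 1
  have hw : ∀ i, (((m' i * (n : ℤ) + ((m₀ i : ℕ) : ℤ) : ℤ)) : ℂ) + a i =
      (n : ℂ) * ((m' i : ℂ) + ((((m₀ i : ℕ) : ℂ)) + a i) / n) := by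
    intro i
    push_cast
    field_simp
    ring
  simp only [dotProduct, Matrix.mulVec, Fin.sum_univ_two, Matrix.smul_apply, Pi.add_apply,
    Pi.smul_apply, smul_eq_mul]
  rw [hw 0, hw 1]
  ring

/-- `n²Ω` has the symmetry and the imaginary-part bound of `Ω` (constant `n² c`). -/
theorem natCast_sq_smul_hyps (Ω : Matrix (Fin 2) (Fin 2) ℂ) (hΩ : ∀ i j, Ω i j = Ω j i) {c : ℝ}
    (hY : ∀ x : Fin 2 → ℝ, c * ∑ i, x i ^ 2 ≤ ∑ i, ∑ j, x i * (Ω i j).im * x j) (n : ℕ) :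
    (∀ i j, (((n : ℂ) ^ 2) • Ω) i j = (((n : ℂ) ^ 2) • Ω) j i) ∧
      ∀ x : Fin 2 → ℝ, (n : ℝ) ^ 2 * c * ∑ i, x i ^ 2 ≤
        ∑ i, ∑ j, x i * ((((n : ℂ) ^ 2) • Ω) i j).im * x j := by
  refine ⟨fun i j => by simp only [Matrix.smul_apply, hΩ i j], fun x => ?_⟩
  have h := hY x
  have e : ∑ i, ∑ j, x i * ((((n : ℂ) ^ 2) • Ω) i j).im * x j =
      (n : ℝ) ^ 2 * ∑ i, ∑ j, x i * (Ω i j).im * x j := by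
    rw [Finset.mul_sum]
    refine Finset.sum_congr rfl fun i _ => ?_
    rw [Finset.mul_sum]
    refine Finset.sum_congr rfl fun j _ => ?_
    have : (((n : ℂ) ^ 2) • Ω) i j = (((n : ℝ) ^ 2 : ℝ) : ℂ) * Ω i j := by
      rw [Matrix.smul_apply, smul_eq_mul]; push_cast; ring
    rw [this, Complex.im_ofReal_mul]
    ring
  rw [e, mul_assoc]
  exact mul_le_mul_of_nonneg_left h (by positivity)

/-- **Level raising**: `ϑ[a; b](z, Ω) = Σ_{m₀ ∈ (ℤ/nℤ)²} ϑ[(m₀ + a)/n; n b](n z, n² Ω)` (`n ≥ 1`). -/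
theorem riemannThetaChar_eq_sum_level (Ω : Matrix (Fin 2) (Fin 2) ℂ) (hΩ : ∀ i j, Ω i j = Ω j i)
    {c : ℝ} (hc : 0 < c) (hY : ∀ x : Fin 2 → ℝ, c * ∑ i, x i ^ 2 ≤ ∑ i, ∑ j, x i * (Ω i j).im * x j)
    (a b z : Fin 2 → ℂ) {n : ℕ} (hn : 0 < n) :
    riemannThetaChar a b Ω z = ∑ m₀ : Fin 2 → Fin n,
      riemannThetaChar (fun i => ((((m₀ i : ℕ) : ℂ)) + a i) / n) ((n : ℂ) • b)
        (((n : ℂ) ^ 2) • Ω) ((n : ℂ) • z) := by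
  haveI : NeZero n := ⟨hn.ne'⟩
  -- reindex `ℤ² ≃ (ℤ/n)² × ℤ²`
  set e : (Fin 2 → ℤ) ≃ (Fin 2 → Fin n) × (Fin 2 → ℤ) :=
    ((Equiv.piCongrRight fun _ : Fin 2 => Int.divModEquiv n).trans
      (Equiv.arrowProdEquivProdArrow (Fin 2) (fun _ => ℤ) (fun _ => Fin n))).trans
      (Equiv.prodComm _ _) with he
  have hesymm : ∀ (p : (Fin 2 → Fin n) × (Fin 2 → ℤ)),
      e.symm p = fun i => p.2 i * (n : ℤ) + ((p.1 i : ℕ) : ℤ) := by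
    intro p
    funext i
    simp [he, Equiv.piCongrRight, Equiv.prodComm, Int.divModEquiv]
  have hsum := hasSum_riemannThetaChar Ω hΩ hc hY a b z
  have hsum' : HasSum (fun p : (Fin 2 → Fin n) × (Fin 2 → ℤ) => riemannThetaCharTerm a b Ω z (e.symm p))
      (riemannThetaChar a b Ω z) := (e.symm.hasSum_iff).mpr hsum
  obtain ⟨hΩ', hY'⟩ := natCast_sq_smul_hyps Ω hΩ hY n
  have hc' : 0 < (n : ℝ) ^ 2 * c := by positivity
  have hfib : ∀ m₀ : Fin 2 → Fin n, HasSum (fun m' : Fin 2 → ℤ => riemannThetaCharTerm a b Ω z (e.symm (m₀, m')))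
      (riemannThetaChar (fun i => ((((m₀ i : ℕ) : ℂ)) + a i) / n) ((n : ℂ) • b)
        (((n : ℂ) ^ 2) • Ω) ((n : ℂ) • z)) := by
    intro m₀
    have h := hasSum_riemannThetaChar _ hΩ' hc' hY' (fun i => ((((m₀ i : ℕ) : ℂ)) + a i) / n)
      ((n : ℂ) • b) ((n : ℂ) • z)
    refine h.congr_fun fun m' => ?_
    rw [hesymm, riemannThetaCharTerm_level a b Ω z hn m₀ m']
  have hfw := hsum'.prod_fiberwise hfib
  exact hfw.unique (hasSum_fintype _)


/-! ### The line `τ·P` of a rational positive definite symmetric `P` -/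

/-- **`τ·P ∈ 𝔥₂`** for `Im τ > 0` and `P ∈ Sym₂(ℚ)` positive definite. -/
theorem smul_ratCast_mem_siegelUpperHalfSpace {P : Matrix (Fin 2) (Fin 2) ℚ} (hPs : P.IsSymm)
    (hPpos : (P.map (Rat.cast : ℚ → ℝ)).PosDef) {τ : ℂ} (hτ : 0 < τ.im) :
    (τ • P.map (Rat.cast : ℚ → ℂ)) ∈ siegelUpperHalfSpace 2 := by
  rw [mem_siegelUpperHalfSpace_iff]
  refine ⟨(hPs.map _).smul τ, ?_⟩
  have hmap : (τ • P.map (Rat.cast : ℚ → ℂ)).map Complex.im = τ.im • P.map (Rat.cast : ℚ → ℝ) := by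
    ext i j
    simp [Complex.mul_im]
  rw [hmap]
  exact hPpos.smul hτ

/-- The hypotheses of the theta-series lemmas at the point `τ·P`. -/
theorem line_hyps {P : Matrix (Fin 2) (Fin 2) ℚ} (hPs : P.IsSymm)
    (hPpos : (P.map (Rat.cast : ℚ → ℝ)).PosDef) {τ : ℂ} (hτ : 0 < τ.im) :
    (∀ i j, (τ • P.map (Rat.cast : ℚ → ℂ)) i j = (τ • P.map (Rat.cast : ℚ → ℂ)) j i) ∧
      ∃ c : ℝ, 0 < c ∧ ∀ x : Fin 2 → ℝ, c * ∑ i, x i ^ 2 ≤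
        ∑ i, ∑ j, x i * ((τ • P.map (Rat.cast : ℚ → ℂ)) i j).im * x j := by
  have hZ := smul_ratCast_mem_siegelUpperHalfSpace hPs hPpos hτ
  exact ⟨fun i j => (hZ.1.apply i j).symm, exists_pos_mul_sum_sq_le_of_posDef_im _ hZ.2⟩

/-- **The size of the general term on the line**: for rational characteristics,
`|e(πi ᵗ(m+a)(zP)(m+a) + 2πi ᵗ(m+a) b)| = e^{-π Im z · ᵗ(m+a)P(m+a)}`. -/
theorem norm_riemannThetaCharTerm_line (P : Matrix (Fin 2) (Fin 2) ℚ) (a b : Fin 2 → ℚ) (z : ℂ)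
    (m : Fin 2 → ℤ) :
    ‖riemannThetaCharTerm (fun i => (a i : ℂ)) (fun i => (b i : ℂ)) (z • P.map (Rat.cast : ℚ → ℂ)) 0 m‖ =
      Real.exp (-(π * z.im * ∑ i, ∑ j, ((m i : ℝ) + a i) * (P i j : ℝ) * ((m j : ℝ) + a j))) := by
  rw [riemannThetaCharTerm, Complex.norm_exp]
  congr 1
  set q : ℝ := ∑ i, ∑ j, ((m i : ℝ) + a i) * (P i j : ℝ) * ((m j : ℝ) + a j) with hq
  set r : ℝ := ∑ i, ((m i : ℝ) + a i) * (b i : ℝ) with hr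
  have h1 : (((fun i => (m i : ℂ)) + fun i => (a i : ℂ)) ⬝ᵥ
      ((z • P.map (Rat.cast : ℚ → ℂ)) *ᵥ ((fun i => (m i : ℂ)) + fun i => (a i : ℂ)))) = z * (q : ℂ) := by
    simp only [dotProduct, mulVec, Fin.sum_univ_two, Matrix.smul_apply, Matrix.map_apply, Pi.add_apply,
      smul_eq_mul, hq]
    push_cast
    ring
  have h2 : (((fun i => (m i : ℂ)) + fun i => (a i : ℂ)) ⬝ᵥ ((0 : Fin 2 → ℂ) + fun i => (b i : ℂ))) =
      (r : ℂ) := by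
    simp only [dotProduct, Fin.sum_univ_two, Pi.add_apply, Pi.zero_apply, zero_add, hr]
    push_cast
    ring
  rw [h1, h2, show π * I * (z * (q : ℂ)) + 2 * π * I * (r : ℂ) =
      ((π * q : ℝ) : ℂ) * (I * z) + ((2 * π * r : ℝ) : ℂ) * I by push_cast; ring,
    Complex.add_re, Complex.re_ofReal_mul, Complex.re_ofReal_mul, Complex.I_mul_re, Complex.I_re]
  ring

/-- The quadratic form of `P` bounds squares: `c Σ xᵢ² ≤ ᵗxPx` for some `c > 0`. -/
theorem exists_pos_quadForm_ge {P : Matrix (Fin 2) (Fin 2) ℚ} (hPs : P.IsSymm)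
    (hPpos : (P.map (Rat.cast : ℚ → ℝ)).PosDef) :
    ∃ c : ℝ, 0 < c ∧ ∀ x : Fin 2 → ℝ, c * ∑ i, x i ^ 2 ≤ ∑ i, ∑ j, x i * (P i j : ℝ) * x j := by
  obtain ⟨-, c, hc, hY⟩ := line_hyps hPs hPpos (τ := I) (by simp)
  refine ⟨c, hc, fun x => ?_⟩
  have h := hY x
  simpa [Matrix.smul_apply, Matrix.map_apply] using h

/-- **Rational characteristics stay away from the lattice**: if `m + a ≠ 0` then
`Σ (mᵢ + aᵢ)² ≥ 1/N²` with `N = den(a₀) den(a₁)`. -/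
theorem sum_sq_ge_of_ne_zero (a : Fin 2 → ℚ) (m : Fin 2 → ℤ) (h : ∃ i, (m i : ℚ) + a i ≠ 0) :
    1 / (((a 0).den * (a 1).den : ℕ) : ℝ) ^ 2 ≤ ∑ i, ((m i : ℝ) + a i) ^ 2 := by
  obtain ⟨i, hi⟩ := h
  set N : ℕ := (a 0).den * (a 1).den with hN
  have hNpos : (0 : ℝ) < N := by
    have : 0 < N := mul_pos (a 0).den_pos (a 1).den_pos
    exact_mod_cast this
  -- `(m i + a i) N` is a nonzero integer
  have hint : ∃ z : ℤ, ((m i : ℚ) + a i) * N = z := by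
    have h0 : (a 0) * N = (a 0).num * (a 1).den := by
      rw [hN]; push_cast; rw [← mul_assoc, Rat.mul_den_eq_num]
    have h1 : (a 1) * N = (a 1).num * (a 0).den := by
      rw [hN]; push_cast; rw [mul_comm ((a 0).den : ℚ), ← mul_assoc, Rat.mul_den_eq_num]
    fin_cases i
    · exact ⟨m 0 * N + (a 0).num * (a 1).den, by push_cast; rw [add_mul, h0]⟩
    · exact ⟨m 1 * N + (a 1).num * (a 0).den, by push_cast; rw [add_mul, h1]⟩
  obtain ⟨z, hz⟩ := hint
  have hz0 : z ≠ 0 := by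
    rintro rfl
    have : ((m i : ℚ) + a i) * N = 0 := by exact_mod_cast hz
    rcases mul_eq_zero.mp this with h | h
    · exact hi h
    · exact hNpos.ne' (by exact_mod_cast h)
  have hz1 : (1 : ℝ) ≤ (z : ℝ) ^ 2 := by
    have : (1 : ℤ) ≤ z ^ 2 := by nlinarith [Int.one_le_abs hz0, sq_abs z]
    exact_mod_cast this
  have hzi : ((m i : ℝ) + a i) = (z : ℝ) / N := by
    have : ((m i : ℝ) + a i) * N = z := by exact_mod_cast hz
    field_simp
    linarith [this]
  calc 1 / ((N : ℕ) : ℝ) ^ 2 ≤ (z : ℝ) ^ 2 / (N : ℝ) ^ 2 := by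
        rw [div_le_div_iff_of_pos_right (by positivity)]; exact hz1
    _ = ((m i : ℝ) + a i) ^ 2 := by rw [hzi, div_pow]
    _ ≤ ∑ j, ((m j : ℝ) + a j) ^ 2 :=
        Finset.single_le_sum (f := fun j => ((m j : ℝ) + a j) ^ 2) (fun j _ => sq_nonneg _)
          (Finset.mem_univ i)

/-- **The gradient theta null on the line tends to `0` at `i∞`** (rational characteristics):
every term of `∇_u ϑ[a;b](0, τ·P) = Σ_m 2πi ᵗ(m+a)u · e(...)` is `O(e^{-π q₀ Im τ})`, `q₀ > 0`,
except the term `m = -a`, whose coefficient vanishes. -/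
theorem isZeroAtImInfty_fderiv_line {P : Matrix (Fin 2) (Fin 2) ℚ} (hPs : P.IsSymm)
    (hPpos : (P.map (Rat.cast : ℚ → ℝ)).PosDef) (a b : Fin 2 → ℚ) (u : Fin 2 → ℂ) :
    UpperHalfPlane.IsZeroAtImInfty (fun τ : ℍ => fderiv ℂ (riemannThetaChar (fun i => (a i : ℂ))
      (fun i => (b i : ℂ)) ((τ : ℂ) • P.map (Rat.cast : ℚ → ℂ))) 0 u) := by
  rw [UpperHalfPlane.isZeroAtImInfty_iff]
  intro ε hε
  set Q : (Fin 2 → ℤ) → ℝ := fun m => ∑ i, ∑ j, ((m i : ℝ) + a i) * (P i j : ℝ) * ((m j : ℝ) + a j) with hQ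
  set A : (Fin 2 → ℤ) → ℝ := fun m =>
    ‖2 * π * I * ((((fun i => (m i : ℂ)) + fun i => (a i : ℂ)) ⬝ᵥ u))‖ * Real.exp (-(π * Q m)) with hAdef
  obtain ⟨c, hc, hcQ⟩ := exists_pos_quadForm_ge hPs hPpos
  set N : ℕ := (a 0).den * (a 1).den with hN
  have hNpos : (0 : ℝ) < N := by
    have : 0 < N := mul_pos (a 0).den_pos (a 1).den_pos
    exact_mod_cast this
  set q₀ : ℝ := c / (N : ℝ) ^ 2 with hq₀
  have hq₀pos : 0 < q₀ := by positivity
  have hQnn : ∀ m, 0 ≤ Q m := fun m =>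
    le_trans (mul_nonneg hc.le (Finset.sum_nonneg fun i _ => sq_nonneg _)) (hcQ _)
  have hQlow : ∀ m : Fin 2 → ℤ, (∃ i, (m i : ℚ) + a i ≠ 0) → q₀ ≤ Q m := by
    intro m hm
    have h1 := sum_sq_ge_of_ne_zero a m hm
    have h2 := hcQ (fun i => (m i : ℝ) + a i)
    calc q₀ = c * (1 / (N : ℝ) ^ 2) := by rw [hq₀]; ring
      _ ≤ c * ∑ i, ((m i : ℝ) + a i) ^ 2 := mul_le_mul_of_nonneg_left h1 hc.le
      _ ≤ Q m := h2
  -- summability of `A` (the term norms at `τ = i`)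
  have hAs : Summable A := by
    obtain ⟨hsym, c', hc', hY'⟩ := line_hyps hPs hPpos (τ := I) (by simp)
    have hS := (hasSum_fderiv_riemannThetaChar_apply _ hsym hc' hY' (fun i => (a i : ℂ))
      (fun i => (b i : ℂ)) 0 u).summable.norm
    refine hS.congr fun m => ?_
    rw [norm_mul, norm_riemannThetaCharTerm_line, hAdef, hQ]
    simp
  set C : ℝ := ∑' m, A m with hC
  have hC0 : 0 ≤ C := tsum_nonneg fun m => by positivity
  -- choose the height
  obtain ⟨Y, hY⟩ : ∃ Y : ℝ, ∀ y ≥ Y, C * Real.exp (-(π * (y - 1) * q₀)) < ε ∧ 1 ≤ y := by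
    have ht : Tendsto (fun y : ℝ => C * Real.exp (-(π * (y - 1) * q₀))) atTop (𝓝 0) := by
      have h1 : Tendsto (fun y : ℝ => -(π * (y - 1) * q₀)) atTop atBot := by
        have : (fun y : ℝ => -(π * (y - 1) * q₀)) = fun y => (-(π * q₀)) * y + π * q₀ := by
          funext y; ring
        rw [this]
        exact tendsto_atBot_add_const_right _ _
          (tendsto_id.const_mul_atTop_of_neg (by nlinarith [Real.pi_pos]))
      simpa using (Real.tendsto_exp_atBot.comp h1).const_mul C
    obtain ⟨Y, hY⟩ := ((ht.eventually (gt_mem_nhds hε)).and (eventually_ge_atTop (1 : ℝ))).exists_forall_of_atTop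
    exact ⟨Y, fun y hy => hY y hy⟩
  refine ⟨Y, fun τ hτ => ?_⟩
  obtain ⟨hlt, hy1⟩ := hY τ.im hτ
  obtain ⟨hsym, c', hc', hY'⟩ := line_hyps hPs hPpos τ.im_pos
  have hS := hasSum_fderiv_riemannThetaChar_apply _ hsym hc' hY' (fun i => (a i : ℂ))
    (fun i => (b i : ℂ)) 0 u
  -- termwise bound
  have hle : ∀ m : Fin 2 → ℤ,
      ‖2 * π * I * ((((fun i => (m i : ℂ)) + fun i => (a i : ℂ)) ⬝ᵥ u)) *
          riemannThetaCharTerm (fun i => (a i : ℂ)) (fun i => (b i : ℂ))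
            (((τ : ℂ)) • P.map (Rat.cast : ℚ → ℂ)) 0 m‖ ≤
        A m * Real.exp (-(π * (τ.im - 1) * q₀)) := by
    intro m
    by_cases hm : ∃ i, (m i : ℚ) + a i ≠ 0
    · rw [norm_mul, norm_riemannThetaCharTerm_line]
      have hexp : Real.exp (-(π * (τ : ℂ).im * Q m)) ≤
          Real.exp (-(π * Q m)) * Real.exp (-(π * (τ.im - 1) * q₀)) := by
        rw [← Real.exp_add, Real.exp_le_exp, UpperHalfPlane.coe_im]
        have h1 := hQlow m hm
        have h2 : 0 ≤ τ.im - 1 := by linarith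
        nlinarith [Real.pi_pos, mul_nonneg h2 (sub_nonneg.mpr h1)]
      calc _ = ‖2 * π * I * ((((fun i => (m i : ℂ)) + fun i => (a i : ℂ)) ⬝ᵥ u))‖ *
            Real.exp (-(π * (τ : ℂ).im * Q m)) := rfl
        _ ≤ ‖2 * π * I * ((((fun i => (m i : ℂ)) + fun i => (a i : ℂ)) ⬝ᵥ u))‖ *
            (Real.exp (-(π * Q m)) * Real.exp (-(π * (τ.im - 1) * q₀))) :=
            mul_le_mul_of_nonneg_left hexp (norm_nonneg _)
        _ = A m * Real.exp (-(π * (τ.im - 1) * q₀)) := by simp only [hAdef]; ring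
    · -- the coefficient vanishes
      push Not at hm
      have h0 : ((fun i => (m i : ℂ)) + fun i => (a i : ℂ)) = 0 := by
        funext i
        have := hm i
        simp only [Pi.add_apply, Pi.zero_apply]
        exact_mod_cast this
      rw [h0, zero_dotProduct, mul_zero, zero_mul, norm_zero]
      positivity
  have hsumm : Summable fun m : Fin 2 → ℤ => A m * Real.exp (-(π * (τ.im - 1) * q₀)) := hAs.mul_right _
  calc ‖fderiv ℂ (riemannThetaChar (fun i => (a i : ℂ)) (fun i => (b i : ℂ))
          (((τ : ℂ)) • P.map (Rat.cast : ℚ → ℂ))) 0 u‖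
      = ‖∑' m : Fin 2 → ℤ, 2 * π * I * ((((fun i => (m i : ℂ)) + fun i => (a i : ℂ)) ⬝ᵥ u)) *
          riemannThetaCharTerm (fun i => (a i : ℂ)) (fun i => (b i : ℂ))
            (((τ : ℂ)) • P.map (Rat.cast : ℚ → ℂ)) 0 m‖ := by rw [hS.tsum_eq]
    _ ≤ ∑' m : Fin 2 → ℤ, ‖2 * π * I * ((((fun i => (m i : ℂ)) + fun i => (a i : ℂ)) ⬝ᵥ u)) *
          riemannThetaCharTerm (fun i => (a i : ℂ)) (fun i => (b i : ℂ))
            (((τ : ℂ)) • P.map (Rat.cast : ℚ → ℂ)) 0 m‖ :=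
        norm_tsum_le_tsum_norm (Summable.of_nonneg_of_le (fun m => norm_nonneg _) hle hsumm)
    _ ≤ ∑' m : Fin 2 → ℤ, A m * Real.exp (-(π * (τ.im - 1) * q₀)) :=
        Summable.tsum_le_tsum hle (Summable.of_nonneg_of_le (fun m => norm_nonneg _) hle hsumm) hsumm
    _ = C * Real.exp (-(π * (τ.im - 1) * q₀)) := by rw [tsum_mul_right]
    _ ≤ ε := hlt.le

end Summit.BirchSwinnertonDyer.BirchSwinnertonDyer.Theorems.HeckeTheta

end
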